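import Summits.KontsevichZagierPeriods.KontsevichZagierPeriods.Theorems.RootDecompQuadraticDescentZetaTwoPairsP4
import Summits.KontsevichZagierPeriods.KontsevichZagierPeriods.Theses.RootDecompQuadraticDescent

/-!
# The ZETA2 stratum (15 census pairs among R1..R6 ∈ π²ℚ) DECIDED in `KZ.relations` (route `RootDecompQuadraticDescent`, instances of crux stmt-KontsevichZagierPeriods-28994 / stmt-4280) · part 5/5

Cell `decomp-kz`, lens 6 (decomp-kz-lens-6 g8b): ENGINE v3.1 — the bounded «triangle calculus» on sub-graph representations `SB(c;L,U)` (`sb_cut/affine/swap/unfold/add′`, `rel_opn/scale/shift/powB` ⟹ `sb_pow`; `rel_scale` over the OPEN base via `KZ.of_sub_of_mem_relations_of_affine`) decides every pair #23 #34 #35 #38–#49 of the cell census as an INTEGER relation (normal forms R1≡2A, R2≡4A−4W, R3≡2A−T, R4≡4W−2T, R5≡2W+2T, R6≡3W, 2T≡A, 3W≡2A); packaged `zetaTwoStratum_descentTwoQ_instances` and `zetaTwoPair_of_kzDimTwo` BY NAME.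

Source: `HOME/decomp-kz-lens-6/g8/ZetaTwoPairs.lean` sha256 a8aac2aea5cc880c (1299 l; critic decomp-kz-crit-1 g2 CLEARED 2026-08-30T09:03:21Z, std axioms), split into 5 modules by the landing seat decomp-kz-census-1 g7 (contexts re-opened per part; generic docstrings added where the source had none; the route file is imported only by the last part, which proves the `KZDimTwo` corollaries BY NAME).  No `sorry`; standard axioms.  References: [cite: KontsevichZagier2001, §1.2].
-/

noncomputable section

open MeasureTheory Set MvPolynomial

namespace Summit.KontsevichZagierPeriods.RootDecompQuadraticDescent.ZetaTwoPairs

open Summit.KontsevichZagierPeriods.KontsevichZagierPeriods.Theses.RootDecompQuadraticDescent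

open Literature.NumberTheory.Transcendental
open Literature.NumberTheory.Transcendental.KZ
open Literature.ModelTheory.ExponentialFields (IsSemialgebraic)

-- PRIVATE copy (landed twin lives in a farm-unbuilt module; dedup.landed): snoc2_zero, snoc2_one, init2_zero, isRational_rep
/-- `snoc2_zero`: auxiliary theorem of the lens-6 development «zeta2» (instances of 28994/4280) — see the module docstring; verbatim from the lens file. -/
@[simp] private theorem snoc2_zero (x : Fin 1 → ℝ) (t : ℝ) : (Fin.snoc x t : Fin 2 → ℝ) 0 = x 0 := rfl

/-- `snoc2_one`: auxiliary theorem of the lens-6 development «zeta2» (instances of 28994/4280) — see the module docstring; verbatim from the lens file. -/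
@[simp] private theorem snoc2_one (x : Fin 1 → ℝ) (t : ℝ) : (Fin.snoc x t : Fin 2 → ℝ) 1 = t := rfl

/-- `init2_zero`: auxiliary theorem of the lens-6 development «zeta2» (instances of 28994/4280) — see the module docstring; verbatim from the lens file. -/
@[simp] private theorem init2_zero (z : Fin 2 → ℝ) : Fin.init z 0 = z 0 := rfl

/-- A regular rational function gives a KZ-rational representation. [folklore] -/
private theorem isRational_rep {M : ℕ} (T : RFun M) : T.rep.IsRational :=
  ⟨T.num, T.den, T.den_ne, fun _ _ => rfl⟩

/-- `r6_atoms`: auxiliary theorem of the lens-6 development «zeta2» (instances of 28994/4280) — see the module docstring; verbatim from the lens file. -/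
private theorem r6_atoms : KZ.of R6.rep - 3 • KZ.of (SB (1 / 2) zeroE yE) ∈ KZ.relations := by
  have h := add_mem (add_mem r6_unf (g6_rel (1 / 2))) (x_rel (1 / 2))
  convert h using 1
  abel

/-- The atom relations `2T ≡ A` and `3W ≡ 2A`. -/
private theorem tA : 2 • KZ.of (SB (1 / 2) zeroE idE) - KZ.of (SB (1 / 2) zeroE oneE) ∈ KZ.relations :=
  tl_rel (1 / 2)
/-- `wA`: auxiliary theorem of the lens-6 development «zeta2» (instances of 28994/4280) — see the module docstring; verbatim from the lens file. -/
private theorem wA : 3 • KZ.of (SB (1 / 2) zeroE yE) - 2 • KZ.of (SB (1 / 2) zeroE oneE) ∈ KZ.relations :=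
  y_rel (1 / 2)

/-! ## §6 The fifteen ZETA2 census pairs DECIDED in `KZ.relations` -/

/-- Census pair #23: `1·[□²,1/(1−x+x²+2xy)] − 1·[□²,1/(1+xy)] ∈ KZ.relations` (ZETA2/ZETA2). -/
theorem pair23 : KZ.of R6.rep - KZ.of R1.rep ∈ KZ.relations := by
  have h := (add_mem (sub_mem r6_atoms r1_atoms) wA)
  convert h using 1
  module

/-- Census pair #34: `2·[□²,1/(1−x+x²+2xy)] − 3·[□²,1/(1+y+xy+y²)] ∈ KZ.relations` (ZETA2/ZETA2). -/
theorem pair34 : 2 • KZ.of R6.rep - 3 • KZ.of R2.rep ∈ KZ.relations := by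
  have h := (add_mem (sub_mem (KZ.relations.zsmul_mem r6_atoms 2) (KZ.relations.zsmul_mem r2_atoms 3)) (KZ.relations.zsmul_mem wA 6))
  convert h using 1
  module

/-- Census pair #35: `2·[□²,1/(1+xy)] − 3·[□²,1/(1+y+xy+y²)] ∈ KZ.relations` (ZETA2/ZETA2). -/
theorem pair35 : 2 • KZ.of R1.rep - 3 • KZ.of R2.rep ∈ KZ.relations := by
  have h := (add_mem (sub_mem (KZ.relations.zsmul_mem r1_atoms 2) (KZ.relations.zsmul_mem r2_atoms 3)) (KZ.relations.zsmul_mem wA 4))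
  convert h using 1
  module

/-- Census pair #38: `3·[□²,1/(1−x+x²+2xy)] − 4·[□²,1/(1+2xy+y²)] ∈ KZ.relations` (ZETA2/ZETA2). -/
theorem pair38 : 3 • KZ.of R6.rep - 4 • KZ.of R3.rep ∈ KZ.relations := by
  have h := (add_mem (add_mem (sub_mem (KZ.relations.zsmul_mem r6_atoms 3) (KZ.relations.zsmul_mem r3_atoms 4)) (KZ.relations.zsmul_mem tA 2)) (KZ.relations.zsmul_mem wA 3))
  convert h using 1
  module

/-- Census pair #39: `3·[□²,1/(1+xy)] − 4·[□²,1/(1+2xy+y²)] ∈ KZ.relations` (ZETA2/ZETA2). -/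
theorem pair39 : 3 • KZ.of R1.rep - 4 • KZ.of R3.rep ∈ KZ.relations := by
  have h := (add_mem (sub_mem (KZ.relations.zsmul_mem r1_atoms 3) (KZ.relations.zsmul_mem r3_atoms 4)) (KZ.relations.zsmul_mem tA 2))
  convert h using 1
  module

/-- Census pair #40: `4·[□²,1/(1+xy+y²)] − 5·[□²,1/(1+y+xy+y²)] ∈ KZ.relations` (ZETA2/ZETA2). -/
theorem pair40 : 4 • KZ.of R4.rep - 5 • KZ.of R2.rep ∈ KZ.relations := by
  have h := (add_mem (add_mem (sub_mem (KZ.relations.zsmul_mem r4_atoms 4) (KZ.relations.zsmul_mem r2_atoms 5)) (KZ.relations.zsmul_mem tA (-4))) (KZ.relations.zsmul_mem wA 12))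
  convert h using 1
  module

/-- Census pair #41: `5·[□²,1/(1−x+x²+2xy)] − 6·[□²,1/(1+xy+y²)] ∈ KZ.relations` (ZETA2/ZETA2). -/
theorem pair41 : 5 • KZ.of R6.rep - 6 • KZ.of R4.rep ∈ KZ.relations := by
  have h := (add_mem (add_mem (sub_mem (KZ.relations.zsmul_mem r6_atoms 5) (KZ.relations.zsmul_mem r4_atoms 6)) (KZ.relations.zsmul_mem tA 6)) (KZ.relations.zsmul_mem wA (-3)))
  convert h using 1
  module

/-- Census pair #42: `5·[□²,1/(1+xy)] − 6·[□²,1/(1+xy+y²)] ∈ KZ.relations` (ZETA2/ZETA2). -/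
theorem pair42 : 5 • KZ.of R1.rep - 6 • KZ.of R4.rep ∈ KZ.relations := by
  have h := (add_mem (add_mem (sub_mem (KZ.relations.zsmul_mem r1_atoms 5) (KZ.relations.zsmul_mem r4_atoms 6)) (KZ.relations.zsmul_mem tA 6)) (KZ.relations.zsmul_mem wA (-8)))
  convert h using 1
  module

/-- Census pair #43: `7·[□²,1/(1−x+x²+2xy)] − 6·[□²,1/(1−x+x²+xy)] ∈ KZ.relations` (ZETA2/ZETA2). -/
theorem pair43 : 7 • KZ.of R6.rep - 6 • KZ.of R5.rep ∈ KZ.relations := by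
  have h := (add_mem (add_mem (sub_mem (KZ.relations.zsmul_mem r6_atoms 7) (KZ.relations.zsmul_mem r5_atoms 6)) (KZ.relations.zsmul_mem tA (-6))) (KZ.relations.zsmul_mem wA 3))
  convert h using 1
  module

/-- Census pair #44: `6·[□²,1/(1−x+x²+xy)] − 7·[□²,1/(1+xy)] ∈ KZ.relations` (ZETA2/ZETA2). -/
theorem pair44 : 6 • KZ.of R5.rep - 7 • KZ.of R1.rep ∈ KZ.relations := by
  have h := (add_mem (add_mem (sub_mem (KZ.relations.zsmul_mem r5_atoms 6) (KZ.relations.zsmul_mem r1_atoms 7)) (KZ.relations.zsmul_mem tA 6)) (KZ.relations.zsmul_mem wA 4))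
  convert h using 1
  module

/-- Census pair #45: `5·[□²,1/(1−x+x²+xy)] − 7·[□²,1/(1+xy+y²)] ∈ KZ.relations` (ZETA2/ZETA2). -/
theorem pair45 : 5 • KZ.of R5.rep - 7 • KZ.of R4.rep ∈ KZ.relations := by
  have h := (add_mem (add_mem (sub_mem (KZ.relations.zsmul_mem r5_atoms 5) (KZ.relations.zsmul_mem r4_atoms 7)) (KZ.relations.zsmul_mem tA 12)) (KZ.relations.zsmul_mem wA (-6)))
  convert h using 1
  module

/-- Census pair #46: `4·[□²,1/(1−x+x²+xy)] − 7·[□²,1/(1+y+xy+y²)] ∈ KZ.relations` (ZETA2/ZETA2). -/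
theorem pair46 : 4 • KZ.of R5.rep - 7 • KZ.of R2.rep ∈ KZ.relations := by
  have h := (add_mem (add_mem (sub_mem (KZ.relations.zsmul_mem r5_atoms 4) (KZ.relations.zsmul_mem r2_atoms 7)) (KZ.relations.zsmul_mem tA 4)) (KZ.relations.zsmul_mem wA 12))
  convert h using 1
  module

/-- Census pair #47: `8·[□²,1/(1+2xy+y²)] − 9·[□²,1/(1+y+xy+y²)] ∈ KZ.relations` (ZETA2/ZETA2). -/
theorem pair47 : 8 • KZ.of R3.rep - 9 • KZ.of R2.rep ∈ KZ.relations := by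
  have h := (add_mem (add_mem (sub_mem (KZ.relations.zsmul_mem r3_atoms 8) (KZ.relations.zsmul_mem r2_atoms 9)) (KZ.relations.zsmul_mem tA (-4))) (KZ.relations.zsmul_mem wA 12))
  convert h using 1
  module

/-- Census pair #48: `10·[□²,1/(1+2xy+y²)] − 9·[□²,1/(1+xy+y²)] ∈ KZ.relations` (ZETA2/ZETA2). -/
theorem pair48 : 10 • KZ.of R3.rep - 9 • KZ.of R4.rep ∈ KZ.relations := by
  have h := (add_mem (add_mem (sub_mem (KZ.relations.zsmul_mem r3_atoms 10) (KZ.relations.zsmul_mem r4_atoms 9)) (KZ.relations.zsmul_mem tA 4)) (KZ.relations.zsmul_mem wA (-12)))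
  convert h using 1
  module

/-- Census pair #49: `9·[□²,1/(1−x+x²+xy)] − 14·[□²,1/(1+2xy+y²)] ∈ KZ.relations` (ZETA2/ZETA2). -/
theorem pair49 : 9 • KZ.of R5.rep - 14 • KZ.of R3.rep ∈ KZ.relations := by
  have h := (add_mem (add_mem (sub_mem (KZ.relations.zsmul_mem r5_atoms 9) (KZ.relations.zsmul_mem r3_atoms 14)) (KZ.relations.zsmul_mem tA 16)) (KZ.relations.zsmul_mem wA 6))
  convert h using 1
  module

/-! ## §7 Packaging: the pairs as DECIDED INSTANCES of the route items -/

/-- Census pair #23 as an equivalence of representations: `[□²,1/(1−x+x²+2xy)] ∼ [□²,1/(1+xy)]`. -/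
theorem pair23_equivalent : KZ.Equivalent R6.rep R1.rep := pair23

/-- `pair23_value`: auxiliary theorem of the lens-6 development «zeta2» (instances of 28994/4280) — see the module docstring; verbatim from the lens file. -/
theorem pair23_value : R6.rep.value = R1.rep.value := KZ.Equivalent.value_eq_holds pair23_equivalent

/-- `zetaTwoPair_decided`: auxiliary theorem of the lens-6 development «zeta2» (instances of 28994/4280) — see the module docstring; verbatim from the lens file. -/
theorem zetaTwoPair_decided :
    R6.rep.IsRational ∧ R1.rep.IsRational ∧ R6.rep.value = R1.rep.value ∧ KZ.Equivalent R6.rep R1.rep :=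
  ⟨isRational_rep _, isRational_rep _, pair23_value, pair23_equivalent⟩

/-- Relative form: all fifteen census differences of the ZETA2 stratum lie in every additive subgroup
`R ⊇ KZ.relations` — instances of the conclusion of `DescentTwoQ` (item 28994) with NO use of its
oracle hypotheses. -/
theorem zetaTwoStratum_descentTwoQ_instances (R : AddSubgroup KZ.FormalRep) (hR : KZ.relations ≤ R) :
    KZ.of R6.rep - KZ.of R1.rep ∈ R ∧ 2 • KZ.of R6.rep - 3 • KZ.of R2.rep ∈ R ∧
    2 • KZ.of R1.rep - 3 • KZ.of R2.rep ∈ R ∧ 3 • KZ.of R6.rep - 4 • KZ.of R3.rep ∈ R ∧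
    3 • KZ.of R1.rep - 4 • KZ.of R3.rep ∈ R ∧ 4 • KZ.of R4.rep - 5 • KZ.of R2.rep ∈ R ∧
    5 • KZ.of R6.rep - 6 • KZ.of R4.rep ∈ R ∧ 5 • KZ.of R1.rep - 6 • KZ.of R4.rep ∈ R ∧
    7 • KZ.of R6.rep - 6 • KZ.of R5.rep ∈ R ∧ 6 • KZ.of R5.rep - 7 • KZ.of R1.rep ∈ R ∧
    5 • KZ.of R5.rep - 7 • KZ.of R4.rep ∈ R ∧ 4 • KZ.of R5.rep - 7 • KZ.of R2.rep ∈ R ∧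
    8 • KZ.of R3.rep - 9 • KZ.of R2.rep ∈ R ∧ 10 • KZ.of R3.rep - 9 • KZ.of R4.rep ∈ R ∧
    9 • KZ.of R5.rep - 14 • KZ.of R3.rep ∈ R :=
  ⟨hR pair23, hR pair34, hR pair35, hR pair38, hR pair39, hR pair40, hR pair41, hR pair42, hR pair43,
    hR pair44, hR pair45, hR pair46, hR pair47, hR pair48, hR pair49⟩

/-- `zetaTwoPair_of_kzDimTwo`: auxiliary theorem of the lens-6 development «zeta2» (instances of 28994/4280) — see the module docstring; verbatim from the lens file. -/
theorem zetaTwoPair_of_kzDimTwo (h : KZDimTwo) : KZ.Equivalent R6.rep R1.rep :=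
  h le_rfl le_rfl _ _ (isRational_rep _) (isRational_rep _) pair23_value

/-- info: 'Summit.KontsevichZagierPeriods.RootDecompQuadraticDescent.ZetaTwoPairs.pair23' depends on axioms: [propext,
 Classical.choice,
 Quot.sound] -/
#guard_msgs in #print axioms pair23

/-- info: 'Summit.KontsevichZagierPeriods.RootDecompQuadraticDescent.ZetaTwoPairs.pair39' depends on axioms: [propext,
 Classical.choice,
 Quot.sound] -/
#guard_msgs in #print axioms pair39

/-- info: 'Summit.KontsevichZagierPeriods.RootDecompQuadraticDescent.ZetaTwoPairs.zetaTwoStratum_descentTwoQ_instances' depends on axioms: [propext,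
 Classical.choice,
 Quot.sound] -/
#guard_msgs in #print axioms zetaTwoStratum_descentTwoQ_instances

/-- info: 'Summit.KontsevichZagierPeriods.RootDecompQuadraticDescent.ZetaTwoPairs.zetaTwoPair_decided' depends on axioms: [propext,
 Classical.choice,
 Quot.sound] -/
#guard_msgs in #print axioms zetaTwoPair_decided

end Summit.KontsevichZagierPeriods.RootDecompQuadraticDescent.ZetaTwoPairs

end
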